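import Summits.BirchSwinnertonDyer.BirchSwinnertonDyer.Theorems.EisensteinPrimesKernelIsogenyCertificateType
import HarnessLib

/-!
# Crux 3 `MazurMCOnCellB` (stmt-BirchSwinnertonDyer-19033), line `twistback` v12 — the SHIFT (Taylor–Descartes) CERTIFICATE for the parity of a kernel line:
# a rational abscissa `t₀` LEFT of every real root of the kernel polynomial `h` (signed Taylor coefficients of `h` at `t₀` all positive) and RIGHT of the
# real locus where `Ψ₂Sq ≤ 0` (`Ψ₂Sq(t₀) > 0` plus a monotonicity / discriminant inequality) ⇒ `Ψ₂Sq > 0` at every real root of `h` (the kernel points are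
# REAL ⇒ the line is EVEN) — for kernel characters of ANY order, in particular order `12` and `4` at `p = 13`, where no square certificate exists

Width seat bsd-line-x2-p1-w6 (gen 11), cell `bsd-eis` (run/shared/lean/pub/bsd-eis/), 2026-08-29; `--supports stmt-BirchSwinnertonDyer-19033 --as helper`.
THEOREMS ONLY (no `def`, no named fact, no `sorry`, no instance). Companion of x2-p1-w5 g6's `…EisensteinPrimesKernelIsogenyCertificateType` (§6
`not_gvPar_of_isogenyCert_of_forall_real_root_pos` wants `hpos : ∀ r : ℝ, h(r) = 0 → 0 < Ψ₂Sq(r)`; §7 there = QUADRATIC `h`) and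
`…EisensteinPrimesKernelIsogenyCertificateSquare` (`cd·Ψ₂Sq = cn·G² + K·h`).

WHY. At a kernel point `P = (x, y)` of a rational `p`-line `Φ` with character `φ`, `Ψ₂Sq(x) = (2y + a₁x + a₃)²` and `2y + a₁x + a₃ ∈ ℚ(P) ∖ ℚ(x)`, `ℚ(x) = ℚ(P)^{±1}`;
a SQUARE certificate `Ψ₂Sq ≡ c·g² (mod h)`, `c ∈ ℚ`, needs a quadratic subfield of `ℚ(P)` not inside `ℚ(x)`, i.e. `−1 ∉ (im φ)²`. For `p ≡ 1 (mod 4)` this FAILS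
whenever `4 ∣ #im φ` — at `p = 13` for `im φ = μ₁₂` (the generic point of `X₀(13)`) and `μ₄`, at `p = 5` for `μ₄` (w5 g6 used §7's quadratic `t₀`-test there) —
so the `p = 13` slice needed another decision procedure for «the kernel points are real» (x2-p1-w6 g11 `…KernelCertP13Display` could only treat the
`X₁(13)/C₃` conic). THIS FILE: since an EVEN unramified line at a multiplicative prime has ALL its `p − 1` nonzero points real (`Φ = E(ℝ)[p]`, on the identity
component), every root of `h` is real and exceeds the largest real zero of `Ψ₂Sq`; a single rational `t₀` in the gap certifies both facts by sign conditions on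
integers:
* §1 `lt_of_sextic_root_of_taylor_pos`: if the signed Taylor coefficients `(−1)ᵏ h⁽ᵏ⁾(t₀)/k!` (`k ≤ 5`) of the monic SEXTIC `h` are all positive, then
  `h(t₀ − y) > 0` for `y ≥ 0`, so every real root `r` of `h` has `t₀ < r` (Descartes with zero sign changes; for `h = ∏ (X − rᵢ)` with all six `rᵢ > t₀` real the
  hypothesis always holds; degree `6 = (13 − 1)/2` is the case at hand — for an odd degree the signs flip, not needed here).
* §2 `Ψ₂Sq_pos_of_lt`: `Ψ₂Sq(r) = Ψ₂Sq(t₀) + (r − t₀)·Q(r − t₀)`, `Q(y) = 4y² + (12t₀ + b₂)y + (12t₀² + 2b₂t₀ + 2b₄)`; if `Ψ₂Sq(t₀) > 0` and either `Q` has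
  non-negative coefficients or negative discriminant (`b₂² − 48t₀² − 8b₂t₀ − 32b₄ < 0`, automatic when `Ψ₂Sq` is monotone), then `Ψ₂Sq > 0` on `(t₀, ∞)`.
* §3 `forall_real_root_pos_of_shift_cert_sextic`: the two combined, with `b₂, b₄, b₆` of `W/ℚ` equal to integers `B2, B4, B6` and all inequalities on
  INTEGERS (closed by `norm_num` / `decide` per curve) — exactly the hypothesis `hpos` of `…KernelIsogenyCertificateType.not_gvPar_of_isogenyCert_of_forall_real_root_pos`
  for `c.h = [h0, h1, h2, h3, h4, h5, 1]`.

HONEST FRAMING: elementary real algebra (no calculus: the Taylor identity and the difference quotient are `ring` identities); nothing about any `L`-value, Selmer group,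
main conjecture or BSD is asserted; closes no stub; nothing is booked; 0 cells / labels / stubs / tiers move; no summit statement / Mazur MC / BSD is proved for any curve.

References: [GreenbergVatsal2000] Thm. (1.3) (parity of the kernel character); [SilvermanAEC2009] III.2.3 (`(2y + a₁x + a₃)² = 4x³ + b₂x² + 2b₄x + b₆`), V.2 (real locus).
-/

set_option autoImplicit false
-- `Summit.BirchSwinnertonDyer.BirchSwinnertonDyer.…`: the summit and its single sub-problem share a name.
set_option linter.dupNamespace false

noncomputable section

open Polynomial Literature.NumberTheory.EllipticCurves.PolyCert

namespace Summit.BirchSwinnertonDyer.BirchSwinnertonDyer.Theorems.EisensteinPrimesKernelIsogenyCertificateShift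

/-! ## §0 Evaluating a monic sextic integer list at a real number -/

/-- `aeval r (ofList [h0, h1, h2, h3, h4, h5, 1]) = r⁶ + h5·r⁵ + h4·r⁴ + h3·r³ + h2·r² + h1·r + h0` over `ℝ`. [folklore] -/
theorem aeval_ofList_sextic (h0 h1 h2 h3 h4 h5 : ℤ) (r : ℝ) :
    aeval r (ofList [h0, h1, h2, h3, h4, h5, 1] : ℚ[X]) =
      r ^ 6 + h5 * r ^ 5 + h4 * r ^ 4 + h3 * r ^ 3 + h2 * r ^ 2 + h1 * r + h0 := by
  simp only [ofList_cons, ofList_nil, map_add, map_mul, aeval_C, aeval_X, mul_zero, add_zero, Int.cast_one,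
    eq_ratCast, Rat.cast_intCast, Rat.cast_one]
  ring

/-! ## §1 Taylor–Descartes: every real root lies right of `t₀` -/

/-- **Sextic Taylor–Descartes test.** If the signed Taylor coefficients `(−1)ᵏ h⁽ᵏ⁾(t₀)/k!` (`k = 0, …, 5`) of the monic sextic
`h = X⁶ + h5X⁵ + h4X⁴ + h3X³ + h2X² + h1X + h0` are all positive, then every real root `r` of `h` satisfies `t₀ < r`
(for `r ≤ t₀`, `h(r) = Σ gₖ (t₀ − r)ᵏ > 0`). [folklore] -/
theorem lt_of_sextic_root_of_taylor_pos {h0 h1 h2 h3 h4 h5 t₀ : ℝ}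
    (g0 : 0 < t₀ ^ 6 + h5 * t₀ ^ 5 + h4 * t₀ ^ 4 + h3 * t₀ ^ 3 + h2 * t₀ ^ 2 + h1 * t₀ + h0)
    (g1 : 0 < -(6 * t₀ ^ 5 + 5 * h5 * t₀ ^ 4 + 4 * h4 * t₀ ^ 3 + 3 * h3 * t₀ ^ 2 + 2 * h2 * t₀ + h1))
    (g2 : 0 < 15 * t₀ ^ 4 + 10 * h5 * t₀ ^ 3 + 6 * h4 * t₀ ^ 2 + 3 * h3 * t₀ + h2)
    (g3 : 0 < -(20 * t₀ ^ 3 + 10 * h5 * t₀ ^ 2 + 4 * h4 * t₀ + h3))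
    (g4 : 0 < 15 * t₀ ^ 2 + 5 * h5 * t₀ + h4)
    (g5 : 0 < -(6 * t₀ + h5))
    {r : ℝ} (hr : r ^ 6 + h5 * r ^ 5 + h4 * r ^ 4 + h3 * r ^ 3 + h2 * r ^ 2 + h1 * r + h0 = 0) : t₀ < r := by
  by_contra hle
  push Not at hle
  set y : ℝ := t₀ - r with hy
  have hy0 : 0 ≤ y := sub_nonneg.mpr hle
  have key : r ^ 6 + h5 * r ^ 5 + h4 * r ^ 4 + h3 * r ^ 3 + h2 * r ^ 2 + h1 * r + h0 =
      (t₀ ^ 6 + h5 * t₀ ^ 5 + h4 * t₀ ^ 4 + h3 * t₀ ^ 3 + h2 * t₀ ^ 2 + h1 * t₀ + h0) +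
      y * (-(6 * t₀ ^ 5 + 5 * h5 * t₀ ^ 4 + 4 * h4 * t₀ ^ 3 + 3 * h3 * t₀ ^ 2 + 2 * h2 * t₀ + h1) +
      y * ((15 * t₀ ^ 4 + 10 * h5 * t₀ ^ 3 + 6 * h4 * t₀ ^ 2 + 3 * h3 * t₀ + h2) +
      y * (-(20 * t₀ ^ 3 + 10 * h5 * t₀ ^ 2 + 4 * h4 * t₀ + h3) +
      y * ((15 * t₀ ^ 2 + 5 * h5 * t₀ + h4) +
      y * (-(6 * t₀ + h5) + y))))) := by
    have : r = t₀ - y := by rw [hy]; ring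
    rw [this]; ring
  have e5 : 0 < -(6 * t₀ + h5) + y := by linarith
  have e4 : 0 < (15 * t₀ ^ 2 + 5 * h5 * t₀ + h4) + y * (-(6 * t₀ + h5) + y) := by
    nlinarith [mul_nonneg hy0 e5.le]
  have e3 : 0 < -(20 * t₀ ^ 3 + 10 * h5 * t₀ ^ 2 + 4 * h4 * t₀ + h3) +
      y * ((15 * t₀ ^ 2 + 5 * h5 * t₀ + h4) + y * (-(6 * t₀ + h5) + y)) := by
    nlinarith [mul_nonneg hy0 e4.le]
  have e2 : 0 < (15 * t₀ ^ 4 + 10 * h5 * t₀ ^ 3 + 6 * h4 * t₀ ^ 2 + 3 * h3 * t₀ + h2) +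
      y * (-(20 * t₀ ^ 3 + 10 * h5 * t₀ ^ 2 + 4 * h4 * t₀ + h3) +
      y * ((15 * t₀ ^ 2 + 5 * h5 * t₀ + h4) + y * (-(6 * t₀ + h5) + y))) := by
    nlinarith [mul_nonneg hy0 e3.le]
  have e1 : 0 < -(6 * t₀ ^ 5 + 5 * h5 * t₀ ^ 4 + 4 * h4 * t₀ ^ 3 + 3 * h3 * t₀ ^ 2 + 2 * h2 * t₀ + h1) +
      y * ((15 * t₀ ^ 4 + 10 * h5 * t₀ ^ 3 + 6 * h4 * t₀ ^ 2 + 3 * h3 * t₀ + h2) +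
      y * (-(20 * t₀ ^ 3 + 10 * h5 * t₀ ^ 2 + 4 * h4 * t₀ + h3) +
      y * ((15 * t₀ ^ 2 + 5 * h5 * t₀ + h4) + y * (-(6 * t₀ + h5) + y)))) := by
    nlinarith [mul_nonneg hy0 e2.le]
  have e0 : 0 < r ^ 6 + h5 * r ^ 5 + h4 * r ^ 4 + h3 * r ^ 3 + h2 * r ^ 2 + h1 * r + h0 := by
    rw [key]; nlinarith [mul_nonneg hy0 e1.le]
  linarith

/-! ## §2 `Ψ₂Sq > 0` right of `t₀` -/

/-- **`Ψ₂Sq > 0` on `(t₀, ∞)` from two integer-checkable conditions at `t₀`.** With `y = r − t₀ > 0`: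
`4r³ + b₂r² + 2b₄r + b₆ = Ψ₂Sq(t₀) + y·Q(y)`, `Q(y) = 4y² + (12t₀ + b₂)y + (12t₀² + 2b₂t₀ + 2b₄)`; if `Ψ₂Sq(t₀) > 0` and either `Q` has non-negative lower
coefficients or `16Q = (8y + 12t₀ + b₂)² − (b₂² − 48t₀² − 8b₂t₀ − 32b₄)` with a negative last bracket, then `Q ≥ 0` and `Ψ₂Sq(r) > 0`. [folklore] -/
theorem Ψ₂Sq_pos_of_lt {b₂ b₄ b₆ t₀ r : ℝ} (hΨ : 0 < 4 * t₀ ^ 3 + b₂ * t₀ ^ 2 + 2 * b₄ * t₀ + b₆)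
    (hQ : (0 ≤ 12 * t₀ + b₂ ∧ 0 ≤ 12 * t₀ ^ 2 + 2 * b₂ * t₀ + 2 * b₄) ∨ b₂ ^ 2 - 48 * t₀ ^ 2 - 8 * b₂ * t₀ - 32 * b₄ < 0)
    (hr : t₀ < r) : 0 < 4 * r ^ 3 + b₂ * r ^ 2 + 2 * b₄ * r + b₆ := by
  set y : ℝ := r - t₀ with hy
  have hy0 : 0 < y := sub_pos.mpr hr
  have key : 4 * r ^ 3 + b₂ * r ^ 2 + 2 * b₄ * r + b₆ =
      (4 * t₀ ^ 3 + b₂ * t₀ ^ 2 + 2 * b₄ * t₀ + b₆) +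
        y * (4 * y ^ 2 + (12 * t₀ + b₂) * y + (12 * t₀ ^ 2 + 2 * b₂ * t₀ + 2 * b₄)) := by
    have : r = t₀ + y := by rw [hy]; ring
    rw [this]; ring
  have hQnn : 0 ≤ 4 * y ^ 2 + (12 * t₀ + b₂) * y + (12 * t₀ ^ 2 + 2 * b₂ * t₀ + 2 * b₄) := by
    rcases hQ with ⟨h1, h2⟩ | hdisc
    · nlinarith [mul_nonneg h1 hy0.le, sq_nonneg y]
    · nlinarith [sq_nonneg (8 * y + 12 * t₀ + b₂)]
  rw [key]
  nlinarith [mul_nonneg hy0.le hQnn]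

/-! ## §3 The shift certificate -/

/-- **The shift certificate (sextic kernel polynomial).** If `b₂, b₄, b₆` of `W/ℚ` are the integers `B2, B4, B6`, the monic sextic
`h = [h0, h1, h2, h3, h4, h5, 1]` has positive signed Taylor coefficients at the integer `t₀` (§1), `Ψ₂Sq(t₀) > 0` and the §2 alternative holds at `t₀`, then
`Ψ₂Sq(r) > 0` at every real root `r` of `h` — the hypothesis `hpos` of `…KernelIsogenyCertificateType.not_gvPar_of_isogenyCert_of_forall_real_root_pos`. All nine
hypotheses are integer inequalities (`norm_num` / `decide` per curve). [folklore] -/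
theorem forall_real_root_pos_of_shift_cert_sextic (W : WeierstrassCurve ℚ) (h0 h1 h2 h3 h4 h5 t₀ B2 B4 B6 : ℤ)
    (hb₂ : W.b₂ = B2) (hb₄ : W.b₄ = B4) (hb₆ : W.b₆ = B6)
    (g0 : 0 < t₀ ^ 6 + h5 * t₀ ^ 5 + h4 * t₀ ^ 4 + h3 * t₀ ^ 3 + h2 * t₀ ^ 2 + h1 * t₀ + h0)
    (g1 : 0 < -(6 * t₀ ^ 5 + 5 * h5 * t₀ ^ 4 + 4 * h4 * t₀ ^ 3 + 3 * h3 * t₀ ^ 2 + 2 * h2 * t₀ + h1))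
    (g2 : 0 < 15 * t₀ ^ 4 + 10 * h5 * t₀ ^ 3 + 6 * h4 * t₀ ^ 2 + 3 * h3 * t₀ + h2)
    (g3 : 0 < -(20 * t₀ ^ 3 + 10 * h5 * t₀ ^ 2 + 4 * h4 * t₀ + h3))
    (g4 : 0 < 15 * t₀ ^ 2 + 5 * h5 * t₀ + h4)
    (g5 : 0 < -(6 * t₀ + h5))
    (hΨ : 0 < 4 * t₀ ^ 3 + B2 * t₀ ^ 2 + 2 * B4 * t₀ + B6)
    (hQ : (0 ≤ 12 * t₀ + B2 ∧ 0 ≤ 12 * t₀ ^ 2 + 2 * B2 * t₀ + 2 * B4) ∨ B2 ^ 2 - 48 * t₀ ^ 2 - 8 * B2 * t₀ - 32 * B4 < 0) :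
    ∀ r : ℝ, aeval r (ofList [h0, h1, h2, h3, h4, h5, 1] : ℚ[X]) = 0 → 0 < aeval r W.Ψ₂Sq := by
  intro r hr
  rw [aeval_ofList_sextic] at hr
  rw [EisensteinPrimesKernelIsogenyCertificateType.aeval_Ψ₂Sq_real, hb₂, hb₄, hb₆]
  push_cast
  have ht : (t₀ : ℝ) < r :=
    lt_of_sextic_root_of_taylor_pos (h0 := (h0 : ℝ)) (h1 := (h1 : ℝ)) (h2 := (h2 : ℝ)) (h3 := (h3 : ℝ)) (h4 := (h4 : ℝ)) (h5 := (h5 : ℝ))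
      (by exact_mod_cast g0) (by exact_mod_cast g1) (by exact_mod_cast g2) (by exact_mod_cast g3) (by exact_mod_cast g4)
      (by exact_mod_cast g5) hr
  refine Ψ₂Sq_pos_of_lt (b₂ := (B2 : ℝ)) (b₄ := (B4 : ℝ)) (b₆ := (B6 : ℝ)) (t₀ := (t₀ : ℝ)) (by exact_mod_cast hΨ) ?_ ht
  rcases hQ with ⟨h1', h2'⟩ | h3'
  · exact Or.inl ⟨by exact_mod_cast h1', by exact_mod_cast h2'⟩
  · exact Or.inr (by exact_mod_cast h3')

end Summit.BirchSwinnertonDyer.BirchSwinnertonDyer.Theorems.EisensteinPrimesKernelIsogenyCertificateShift
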